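import Literature.Geometry.Symplectic.NearSymplecticPullbackTransport
import Literature.Geometry.Symplectic.AxisZerosIsolated
import HarnessLib

/-!
# Near a circle of transverse zeros, the zeros of a `2`-form are the circle (tube coordinates)

Topic `Geometry/Symplectic`; namespace `Literature.Geometry.Symplectic`.  Theorems only; no named
fact, no `sorry`.  The manifold layer over `AxisZerosIsolated.lean` (Perutz 2006, Lemma 1.2:
"`Z_ω` is a `1`-submanifold", here in the form used by the normal-form construction): let
`χ : ℝ⁴ → M` be a tubular chart about a loop `γ` — `C^∞` on `hondaTube r`, `2π`-periodic in
`θ = q 0`, with injective differential on the tube and `χ(θ, 0) = γ(θ)` (the output of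
`IsZeroCircle.exists_tubularChart`) — and let `sf` be a `2`-form smooth along the tube all of whose
values `sf(γ θ)` are TRANSVERSE zeros.  Then there is `0 < r' ≤ r` such that the zeros of `sf` in
`χ(hondaTube r')` are exactly the points of the axis:

* `exists_radius_forall_apply_eq_zero_mem_hondaAxis` — `q ∈ hondaTube r'`, `sf(χ q) = 0 ⇒ q ∈ hondaAxis`;
* `exists_radius_zeroLocus_inter_image_eq` — `Z_sf ∩ χ(hondaTube r') = χ(hondaAxis)`.

Proof: the pull-back `G = χ^* sf : ℝ⁴ → Λ²(ℝ⁴)*` is `C^∞` on the tube (`MForm.SmoothAt.pullback`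
read on the model space), `2π`-periodic there (`pullback_apply_add_eq_of_forall`), zero on the
axis, and at axis points its derivative is the transported gradient (`zeroGradient_eq_fderiv_model`,
`IsTransverseZero.pullback`): rank `3` with kernel the axis direction
(`fderiv_apply_eq_zero_of_forall_line`), hence injective on the normal slice
(`injective_on_slice_of_finrank_ker_eq_one`); `exists_radius_forall_eq_zero_mem_hondaAxis`
applies to the periodic extension of `G` by zero off the tube.

## References

* T. Perutz, *Zero-sets of near-symplectic forms*, J. Symplectic Geom. 4 (2006), Lemma 1.2. [Perutz2006]
* K. Honda, *Local properties of self-dual harmonic 2-forms on a 4-manifold*,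
  J. reine angew. Math. 577 (2004), §2. [Honda2004LocalSD]
-/

noncomputable section

open scoped Manifold ContDiff Topology
open Set Function Filter Metric Real Module Literature.Geometry.Kaehler

namespace Literature.Geometry.Symplectic

/-! ### Calculus on `ℝ⁴`: derivative along a line of zeros; kernels of rank-one defect -/

/-- **A function vanishing on a line has zero derivative along it**: if `G (p + t e) = 0` for all
`t` and `G` is differentiable at `p`, then `DG(p) e = 0`. [folklore] -/
theorem fderiv_apply_eq_zero_of_forall_line {V : Type*} [NormedAddCommGroup V] [NormedSpace ℝ V]
    {G : EuclideanSpace ℝ (Fin 4) → V} {p e : EuclideanSpace ℝ (Fin 4)}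
    (hG : DifferentiableAt ℝ G p) (h0 : ∀ t : ℝ, G (p + t • e) = 0) : fderiv ℝ G p e = 0 := by
  have hline : HasDerivAt (fun t : ℝ ↦ p + t • e) e 0 := by
    simpa using ((hasDerivAt_id (0 : ℝ)).smul_const e).const_add p
  have hGp : HasFDerivAt G (fderiv ℝ G p) (p + (0 : ℝ) • e) := by
    simpa using hG.hasFDerivAt
  have hcomp : HasDerivAt (G ∘ fun t : ℝ ↦ p + t • e) (fderiv ℝ G p e) 0 :=
    HasFDerivAt.comp_hasDerivAt (x := (0 : ℝ)) (f := fun t : ℝ ↦ p + t • e) hGp hline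
  have hzero : HasDerivAt (fun t : ℝ ↦ G (p + t • e)) 0 0 := by
    have : (fun t : ℝ ↦ G (p + t • e)) = fun _ ↦ 0 := funext h0
    rw [this]
    exact hasDerivAt_const 0 0
  exact hcomp.unique hzero

/-- **Rank-one kernel spanned by the axis direction is transverse to the normal slice**: if
`ker L` is `1`-dimensional and contains `e₀ = (1, 0, 0, 0)`, then `L` is injective on
`{w | w 0 = 0}`. [folklore] -/
theorem injective_on_slice_of_finrank_ker_eq_one {V : Type*} [AddCommGroup V] [Module ℝ V]
    (L : EuclideanSpace ℝ (Fin 4) →ₗ[ℝ] V) (hk : finrank ℝ (LinearMap.ker L) = 1)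
    (he : L (EuclideanSpace.single (0 : Fin 4) (1 : ℝ)) = 0) (w : EuclideanSpace ℝ (Fin 4))
    (hw0 : w 0 = 0) (hw : L w = 0) : w = 0 := by
  set e₀ : EuclideanSpace ℝ (Fin 4) := EuclideanSpace.single (0 : Fin 4) (1 : ℝ) with he₀
  have he₀k : e₀ ∈ LinearMap.ker L := LinearMap.mem_ker.2 he
  have he₀ne : (⟨e₀, he₀k⟩ : LinearMap.ker L) ≠ 0 := by
    intro h
    have h1 : e₀ = 0 := congrArg Subtype.val h
    have h2 : e₀ 0 = (0 : EuclideanSpace ℝ (Fin 4)) 0 := by rw [h1]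
    simp [he₀] at h2
  obtain ⟨c, hc⟩ := (finrank_eq_one_iff_of_nonzero' _ he₀ne).1 hk ⟨w, LinearMap.mem_ker.2 hw⟩
  have hcw : c • e₀ = w := congrArg Subtype.val hc
  have hc0 : c = 0 := by
    have h1 : (c • e₀) 0 = w 0 := by rw [hcw]
    simpa [he₀, hw0] using h1
  rw [← hcw, hc0, zero_smul]

/-! ### Forms on the model space `ℝ⁴`: gradient, periodicity of pull-backs -/

/-- **On the model space the chart gradient is the Fréchet derivative** of the form regarded as a
map `ℝ⁴ → Λ²(ℝ⁴)*` (the charts are the identity). [cite: Perutz2006, Def. 1.1] -/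
theorem zeroGradient_eq_fderiv_model
    (β : MForm 𝓘(ℝ, EuclideanSpace ℝ (Fin 4)) (EuclideanSpace ℝ (Fin 4)) ℝ 2)
    (x : EuclideanSpace ℝ (Fin 4)) :
    zeroGradient β x = fderiv ℝ (fun y ↦ β y :
      EuclideanSpace ℝ (Fin 4) → (EuclideanSpace ℝ (Fin 4)) [⋀^Fin 2]→L[ℝ] ℝ) x := by
  rw [zeroGradient, inChart_eq_self_model]
  have hx : extChartAt 𝓘(ℝ, EuclideanSpace ℝ (Fin 4)) x x = x := by simp
  rw [show extChartAt (𝓡 4) x x = x from hx]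

variable {M : Type*} [TopologicalSpace M] [ChartedSpace (EuclideanSpace ℝ (Fin 4)) M]

/-- **The differential of a periodic map is periodic**: if `χ (q + p₀) = χ q` for all `q` and `χ`
is differentiable at `x + p₀`, then `dχ_x = dχ_{x + p₀}` (chain rule with the translation).
[folklore] -/
theorem mfderiv_eq_mfderiv_add_of_forall {χ : EuclideanSpace ℝ (Fin 4) → M}
    {p₀ : EuclideanSpace ℝ (Fin 4)} (hper : ∀ q, χ (q + p₀) = χ q) {x : EuclideanSpace ℝ (Fin 4)}
    (hd : MDifferentiableAt 𝓘(ℝ, EuclideanSpace ℝ (Fin 4)) (𝓡 4) χ (x + p₀)) :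
    (mfderiv 𝓘(ℝ, EuclideanSpace ℝ (Fin 4)) (𝓡 4) χ x :
        EuclideanSpace ℝ (Fin 4) →L[ℝ] EuclideanSpace ℝ (Fin 4)) =
      mfderiv 𝓘(ℝ, EuclideanSpace ℝ (Fin 4)) (𝓡 4) χ (x + p₀) := by
  have hT : HasMFDerivAt 𝓘(ℝ, EuclideanSpace ℝ (Fin 4)) 𝓘(ℝ, EuclideanSpace ℝ (Fin 4))
      (fun q : EuclideanSpace ℝ (Fin 4) ↦ q + p₀) x
      (ContinuousLinearMap.id ℝ (EuclideanSpace ℝ (Fin 4))) :=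
    ((hasFDerivAt_id x).add_const p₀).hasMFDerivAt
  have h1 : HasMFDerivAt 𝓘(ℝ, EuclideanSpace ℝ (Fin 4)) (𝓡 4)
      (χ ∘ fun q : EuclideanSpace ℝ (Fin 4) ↦ q + p₀) x
      ((mfderiv 𝓘(ℝ, EuclideanSpace ℝ (Fin 4)) (𝓡 4) χ (x + p₀)).comp
        (ContinuousLinearMap.id ℝ (EuclideanSpace ℝ (Fin 4)))) :=
    hd.hasMFDerivAt.comp x hT
  have h2 : HasMFDerivAt 𝓘(ℝ, EuclideanSpace ℝ (Fin 4)) (𝓡 4) χ x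
      ((mfderiv 𝓘(ℝ, EuclideanSpace ℝ (Fin 4)) (𝓡 4) χ (x + p₀)).comp
        (ContinuousLinearMap.id ℝ (EuclideanSpace ℝ (Fin 4)))) :=
    h1.congr_of_eventuallyEq (Eventually.of_forall fun q ↦ (hper q).symm)
  rw [h2.mfderiv]
  exact ContinuousLinearMap.ext fun v ↦ rfl

/-- **Pull-backs along periodic maps are periodic** (where the map is differentiable):
`(χ^* sf)(x + p₀)(v) = (χ^* sf)(x)(v)` (pointwise in `v : Fin 2 → ℝ⁴`, so that both sides are
real numbers). [folklore] -/
theorem pullback_apply_add_eq_of_forall {sf : MForm (𝓡 4) M ℝ 2}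
    {χ : EuclideanSpace ℝ (Fin 4) → M} {p₀ : EuclideanSpace ℝ (Fin 4)}
    (hper : ∀ q, χ (q + p₀) = χ q) {x : EuclideanSpace ℝ (Fin 4)}
    (hd : MDifferentiableAt 𝓘(ℝ, EuclideanSpace ℝ (Fin 4)) (𝓡 4) χ (x + p₀))
    (v : Fin 2 → EuclideanSpace ℝ (Fin 4)) :
    sf.pullback 𝓘(ℝ, EuclideanSpace ℝ (Fin 4)) χ (x + p₀) v =
      sf.pullback 𝓘(ℝ, EuclideanSpace ℝ (Fin 4)) χ x v := by
  have key : ∀ {a b : M} (_ : a = b) (w : Fin 2 → EuclideanSpace ℝ (Fin 4)), sf a w = sf b w := by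
    intro a b h w; subst h; rfl
  have hm := mfderiv_eq_mfderiv_add_of_forall hper hd
  have h1 : (fun i ↦ (mfderiv 𝓘(ℝ, EuclideanSpace ℝ (Fin 4)) (𝓡 4) χ (x + p₀) (v i) :
      EuclideanSpace ℝ (Fin 4))) =
      fun i ↦ (mfderiv 𝓘(ℝ, EuclideanSpace ℝ (Fin 4)) (𝓡 4) χ x (v i) :
        EuclideanSpace ℝ (Fin 4)) :=
    funext fun i ↦ congrArg
      (fun L : EuclideanSpace ℝ (Fin 4) →L[ℝ] EuclideanSpace ℝ (Fin 4) ↦ L (v i)) hm.symm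
  calc sf.pullback 𝓘(ℝ, EuclideanSpace ℝ (Fin 4)) χ (x + p₀) v
      = sf (χ (x + p₀)) (fun i ↦ mfderiv 𝓘(ℝ, EuclideanSpace ℝ (Fin 4)) (𝓡 4) χ (x + p₀) (v i)) :=
        rfl
    _ = sf (χ x) (fun i ↦ mfderiv 𝓘(ℝ, EuclideanSpace ℝ (Fin 4)) (𝓡 4) χ (x + p₀) (v i)) :=
        key (hper x) _
    _ = sf (χ x) (fun i ↦ mfderiv 𝓘(ℝ, EuclideanSpace ℝ (Fin 4)) (𝓡 4) χ x (v i)) :=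
        congrArg (fun w : Fin 2 → EuclideanSpace ℝ (Fin 4) ↦ sf (χ x) w) h1
    _ = sf.pullback 𝓘(ℝ, EuclideanSpace ℝ (Fin 4)) χ x v := rfl

variable [IsManifold (𝓡 4) ∞ M]

/-- **The pull-back of a form along a tube chart is `C^∞` on the tube** as a map
`ℝ⁴ → Λ²(ℝ⁴)*` (`MForm.SmoothAt.pullback` read on the model space, where charts are the identity).
[folklore] -/
theorem contDiffAt_pullback_of_mem_hondaTube {sf : MForm (𝓡 4) M ℝ 2}
    {χ : EuclideanSpace ℝ (Fin 4) → M} {r : ℝ}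
    (hχs : ContMDiffOn 𝓘(ℝ, EuclideanSpace ℝ (Fin 4)) (𝓡 4) ∞ χ (hondaTube r))
    (hsm : ∀ q ∈ hondaTube r, sf.SmoothAt (χ q)) {q : EuclideanSpace ℝ (Fin 4)}
    (hq : q ∈ hondaTube r) :
    ContDiffAt ℝ (F := (EuclideanSpace ℝ (Fin 4)) [⋀^Fin 2]→L[ℝ] ℝ) ∞
      (fun y ↦ sf.pullback 𝓘(ℝ, EuclideanSpace ℝ (Fin 4)) χ y) q := by
  have hev : ∀ᶠ z in 𝓝 q, ContMDiffAt 𝓘(ℝ, EuclideanSpace ℝ (Fin 4)) (𝓡 4) ∞ χ z :=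
    Filter.eventually_of_mem ((isOpen_hondaTube r).mem_nhds hq) fun z hz ↦
      (hχs z hz).contMDiffAt ((isOpen_hondaTube r).mem_nhds hz)
  have h := MForm.SmoothAt.pullback (I := 𝓘(ℝ, EuclideanSpace ℝ (Fin 4))) hev (hsm q hq)
  unfold MForm.SmoothAt at h
  rw [inChart_eq_self_model] at h
  have hx : extChartAt 𝓘(ℝ, EuclideanSpace ℝ (Fin 4)) q q = q := by simp
  rw [hx] at h
  simpa [contDiffWithinAt_univ] using h

/-! ### The main statement -/

set_option maxHeartbeats 800000 in
/-- **Near a circle of transverse zeros, the zeros in the tube are on the axis.**  Let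
`χ : ℝ⁴ → M` be `C^∞` on `hondaTube r` (`0 < r`), `2π`-periodic in `θ`, with injective
differential on the tube and `χ(θ, 0, 0, 0) = γ(θ)`; let `sf` be smooth at the points
`χ(hondaTube r)` with `sf(γ θ)` a transverse zero for every `θ`.  Then for some `0 < r' ≤ r`:
`q ∈ hondaTube r'`, `sf(χ q) = 0 ⇒ q ∈ hondaAxis`. [cite: Perutz2006, Lemma 1.2] -/
theorem exists_radius_forall_apply_eq_zero_mem_hondaAxis {sf : MForm (𝓡 4) M ℝ 2} {γ : ℝ → M}
    {χ : EuclideanSpace ℝ (Fin 4) → M} {r : ℝ} (hr : 0 < r)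
    (hχs : ContMDiffOn 𝓘(ℝ, EuclideanSpace ℝ (Fin 4)) (𝓡 4) ∞ χ (hondaTube r))
    (hχper : ∀ q, χ (q + (2 * π) • EuclideanSpace.single (0 : Fin 4) (1 : ℝ)) = χ q)
    (hχinj : ∀ q ∈ hondaTube r,
      Injective (mfderiv 𝓘(ℝ, EuclideanSpace ℝ (Fin 4)) (𝓡 4) χ q))
    (hχγ : ∀ q ∈ hondaAxis, χ q = γ (q 0))
    (hsm : ∀ q ∈ hondaTube r, sf.SmoothAt (χ q)) (hZ : ∀ θ, IsTransverseZero sf (γ θ)) :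
    ∃ r' : ℝ, 0 < r' ∧ r' ≤ r ∧ ∀ q ∈ hondaTube r', sf (χ q) = 0 → q ∈ hondaAxis := by
  classical
  set p₀ : EuclideanSpace ℝ (Fin 4) := (2 * π) • EuclideanSpace.single (0 : Fin 4) (1 : ℝ)
    with hp₀
  set G : EuclideanSpace ℝ (Fin 4) → (EuclideanSpace ℝ (Fin 4)) [⋀^Fin 2]→L[ℝ] ℝ :=
    fun y ↦ sf.pullback 𝓘(ℝ, EuclideanSpace ℝ (Fin 4)) χ y with hG
  -- transports along equal base points
  have key0 : ∀ {a b : M}, a = b → sf b = 0 → sf a = 0 := by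
    rintro a b rfl h; exact h
  have keyT : ∀ {a b : M}, a = b → IsTransverseZero sf b → IsTransverseZero sf a := by
    rintro a b rfl h; exact h
  have hOpen := isOpen_hondaTube r
  have hmd : ∀ q ∈ hondaTube r,
      MDifferentiableAt 𝓘(ℝ, EuclideanSpace ℝ (Fin 4)) (𝓡 4) χ q := fun q hq ↦
    ((hχs q hq).contMDiffAt (hOpen.mem_nhds hq)).mdifferentiableAt (by simp)
  have hshift : ∀ q : EuclideanSpace ℝ (Fin 4), q + p₀ ∈ hondaTube r ↔ q ∈ hondaTube r := by
    intro q
    refine ⟨fun h ↦ ?_, fun h ↦ add_smul_single_mem_hondaTube h _⟩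
    have h2 := add_smul_single_mem_hondaTube h (-(2 * π))
    rwa [hp₀, add_assoc, ← add_smul, add_neg_cancel, zero_smul, add_zero] at h2
  -- (1) `G` is `C^∞` on the tube, periodic on the tube, zero on the axis
  have hGs : ∀ q ∈ hondaTube r, ContDiffAt ℝ ∞ G q := fun q hq ↦
    contDiffAt_pullback_of_mem_hondaTube hχs hsm hq
  have hGper : ∀ q ∈ hondaTube r, G (q + p₀) = G q := fun q hq ↦
    ContinuousAlternatingMap.ext fun v ↦
      pullback_apply_add_eq_of_forall hχper (hmd _ ((hshift q).2 hq)) v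
  have hsf0 : ∀ q ∈ hondaAxis, sf (χ q) = 0 := fun q hq ↦
    key0 (hχγ q hq) (hZ (q 0)).1
  have hG0 : ∀ q ∈ hondaAxis, G q = 0 := fun q hq ↦ pullback_apply_eq_zero (hsf0 q hq)
  -- (2) injectivity of `DG` on the normal slice at axis points
  have hGinj : ∀ p ∈ hondaAxis, ∀ w : EuclideanSpace ℝ (Fin 4), w 0 = 0 →
      fderiv ℝ G p w = 0 → w = 0 := by
    intro p hp w hw0 hw
    have hpT : p ∈ hondaTube r := hondaAxis_subset_hondaTube hr hp
    have hev : ∀ᶠ z in 𝓝 p, ContMDiffAt 𝓘(ℝ, EuclideanSpace ℝ (Fin 4)) (𝓡 4) ∞ χ z :=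
      Filter.eventually_of_mem (hOpen.mem_nhds hpT) fun z hz ↦
        (hχs z hz).contMDiffAt (hOpen.mem_nhds hz)
    have hinj' : Injective (flatDifferential χ p) := hχinj p hpT
    have hbij : Bijective (flatDifferential χ p) :=
      ⟨hinj', (LinearMap.injective_iff_surjective
        (f := ((flatDifferential χ p : EuclideanSpace ℝ (Fin 4) →L[ℝ] EuclideanSpace ℝ (Fin 4)) :
          EuclideanSpace ℝ (Fin 4) →ₗ[ℝ] EuclideanSpace ℝ (Fin 4)))).1 hinj'⟩
    have hT : IsTransverseZero (sf.pullback 𝓘(ℝ, EuclideanSpace ℝ (Fin 4)) χ) p :=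
      (keyT (hχγ p hp) (hZ (p 0))).pullback hev (hsm p hpT) hbij
    have hgrad : zeroGradient (sf.pullback 𝓘(ℝ, EuclideanSpace ℝ (Fin 4)) χ) p = fderiv ℝ G p :=
      zeroGradient_eq_fderiv_model _ p
    -- the axis direction is in the kernel
    have he : fderiv ℝ G p (EuclideanSpace.single (0 : Fin 4) (1 : ℝ)) = 0 := by
      refine fderiv_apply_eq_zero_of_forall_line ((hGs p hpT).differentiableAt (by simp)) ?_
      intro t
      exact hG0 _ (mem_hondaAxis_add_smul_single_iff.2 hp)
    have hk := hT.finrank_ker_eq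
    rw [hgrad] at hk
    exact injective_on_slice_of_finrank_ker_eq_one (fderiv ℝ G p).toLinearMap hk he w hw0 hw
  -- (3) the periodic extension of `G` by zero off the tube
  set F : EuclideanSpace ℝ (Fin 4) → (EuclideanSpace ℝ (Fin 4)) [⋀^Fin 2]→L[ℝ] ℝ :=
    (hondaTube r).piecewise G 0 with hF
  have hFG : EqOn F G (hondaTube r) := Set.piecewise_eqOn _ _ _
  have hF1 : ContDiffOn ℝ 1 F (hondaTube r) := by
    refine ContDiffOn.congr (fun q hq ↦ ((hGs q hq).of_le ?_).contDiffWithinAt)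
      fun q hq ↦ hFG hq
    exact_mod_cast le_top
  have hFper : ∀ q, F (q + p₀) = F q := by
    intro q
    by_cases hq : q ∈ hondaTube r
    · rw [hFG ((hshift q).2 hq), hFG hq, hGper q hq]
    · have hq' : q + p₀ ∉ hondaTube r := fun h ↦ hq ((hshift q).1 h)
      rw [hF, Set.piecewise_eq_of_notMem _ _ _ hq', Set.piecewise_eq_of_notMem _ _ _ hq]
      rfl
  have hF0 : ∀ q ∈ hondaAxis, F q = 0 := fun q hq ↦ by
    rw [hFG (hondaAxis_subset_hondaTube hr hq), hG0 q hq]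
  have hFinj : ∀ q ∈ hondaAxis, ∀ w : EuclideanSpace ℝ (Fin 4), w 0 = 0 →
      fderiv ℝ F q w = 0 → w = 0 := by
    intro q hq w hw0 hw
    have hfd : fderiv ℝ F q = fderiv ℝ G q :=
      (hFG.eventuallyEq_of_mem (hOpen.mem_nhds (hondaAxis_subset_hondaTube hr hq))).fderiv_eq
    rw [hfd] at hw
    exact hGinj q hq w hw0 hw
  -- (4) conclude
  obtain ⟨r', hr', hr'r, hP⟩ :=
    exists_radius_forall_eq_zero_mem_hondaAxis hr hF1 (by simpa [hp₀] using hFper) hF0 hFinj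
  refine ⟨r', hr', hr'r, fun q hq h0 ↦ hP q hq ?_⟩
  have hqT : q ∈ hondaTube r := by
    rw [mem_hondaTube] at hq ⊢
    nlinarith
  rw [hFG hqT]
  exact pullback_apply_eq_zero h0

/-- **`Z_sf ∩ χ(hondaTube r') = χ(hondaAxis)`** for the radius of
`exists_radius_forall_apply_eq_zero_mem_hondaAxis`: inside the thin tube the zero locus of `sf`
is the image of the axis, i.e. the circle `γ`. [cite: Perutz2006, Lemma 1.2] -/
theorem exists_radius_zeroLocus_inter_image_eq {sf : MForm (𝓡 4) M ℝ 2} {γ : ℝ → M}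
    {χ : EuclideanSpace ℝ (Fin 4) → M} {r : ℝ} (hr : 0 < r)
    (hχs : ContMDiffOn 𝓘(ℝ, EuclideanSpace ℝ (Fin 4)) (𝓡 4) ∞ χ (hondaTube r))
    (hχper : ∀ q, χ (q + (2 * π) • EuclideanSpace.single (0 : Fin 4) (1 : ℝ)) = χ q)
    (hχinj : ∀ q ∈ hondaTube r,
      Injective (mfderiv 𝓘(ℝ, EuclideanSpace ℝ (Fin 4)) (𝓡 4) χ q))
    (hχγ : ∀ q ∈ hondaAxis, χ q = γ (q 0))
    (hsm : ∀ q ∈ hondaTube r, sf.SmoothAt (χ q)) (hZ : ∀ θ, IsTransverseZero sf (γ θ)) :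
    ∃ r' : ℝ, 0 < r' ∧ r' ≤ r ∧ zeroLocus sf ∩ χ '' hondaTube r' = χ '' hondaAxis := by
  obtain ⟨r', hr', hr'r, hP⟩ :=
    exists_radius_forall_apply_eq_zero_mem_hondaAxis hr hχs hχper hχinj hχγ hsm hZ
  have key0 : ∀ {a b : M}, a = b → sf b = 0 → sf a = 0 := by
    rintro a b rfl h; exact h
  refine ⟨r', hr', hr'r, Set.Subset.antisymm ?_ ?_⟩
  · rintro x ⟨hx, q, hq, rfl⟩
    exact ⟨q, hP q hq hx, rfl⟩
  · rintro x ⟨q, hq, rfl⟩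
    exact ⟨key0 (hχγ q hq) (hZ (q 0)).1, q, hondaAxis_subset_hondaTube hr' hq, rfl⟩

end Literature.Geometry.Symplectic

end
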